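import Summits.QuantumFields.YangMills.Theorems.LangevinControlUVOSLegsAtWeakCouplingCStubInheritPair
import HarnessLib

/-!
# Stub `stub_inherit` of line `inherited-amplitude-gates` (crux `OSLegsAtWeakCouplingC`, stmt-QuantumFields-16207):
# auxiliary file 4 — geometry of a deep pair and the arithmetic of the gate parameters

* `two_mul_depth_le`, `depth_le_depth_add_single_add`: `2·depth ≤ b + 1`; `depth` is 1-Lipschitz along `e₂`;
* `pair_geometry`: for `ν = ‖y − x‖ ≥ 1`, a collar `(2κ' + 2κ₇ + 4) ν` at both ends and `m = ⌈ν⌉`, the axis pair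
  `(x, x + m e₂)` meets every depth / size condition of the solve, shape and gate steps;
* `kappaU_spec`, `kappa_mono`, `sqrt3_pow_eight`: the fixed gate parameter `κ_U = ⌈2√C_g⌉ + ⌈2√C_g'⌉ + 8` and the
  eighth root used for the scale-dependent one.

Refs: line card `Cruxes/OSLegsAtWeakCouplingC/Lines/inherited-amplitude-gates.md` (stub_inherit (v)).
-/

set_option autoImplicit false

noncomputable section

open scoped BigOperators
open MeasureTheory Filter Topology
open Literature.MathematicalPhysics.QuantumFieldTheory Literature.MathematicalPhysics.QuantumLattice
open Literature.MathematicalPhysics.AQFT Literature.Probability.LatticeModels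
open Summit.QuantumFields.YangMills.Cruxes.OSLegsFromFemtoAndGap.DlrCollarTransfer

namespace Summit.QuantumFields.YangMills.Cruxes.OSLegsAtWeakCouplingC.InheritedAmplitudeGates.StubInherit

/-! ### Depth geometry -/

/-- A site of positive depth sits inside the cube: `2 · depth ≤ b + 1`. [folklore] -/
theorem two_mul_depth_le (c : Fin 4 → ℤ) (b : ℕ) (x : Fin 4 → ℤ) : 2 * depth c b x ≤ b + 1 := by
  have h : depth c b x ≤ min (x 0 - c 0 + 1).toNat (c 0 + b - x 0).toNat := by
    unfold depth
    exact Finset.inf'_le _ (Finset.mem_univ (0 : Fin 4))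
  omega

/-- `depth` is 1-Lipschitz along the `e₂` axis: `depth x ≤ depth (x + m e₂) + m`. [folklore] -/
theorem depth_le_depth_add_single_add (c : Fin 4 → ℤ) (b : ℕ) (x : Fin 4 → ℤ) (m : ℕ) :
    depth c b x ≤ depth c b (x + Pi.single (2 : Fin 4) (m : ℤ)) + m := by
  set z : Fin 4 → ℤ := x + Pi.single (2 : Fin 4) (m : ℤ) with hz
  obtain ⟨j₀, -, hj₀⟩ := Finset.exists_mem_eq_inf' Finset.univ_nonempty
    (fun j : Fin 4 => min (z j - c j + 1).toNat (c j + b - z j).toNat)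
  have hdz : depth c b z = min (z j₀ - c j₀ + 1).toNat (c j₀ + b - z j₀).toNat := hj₀
  have h : depth c b x ≤ min (x j₀ - c j₀ + 1).toNat (c j₀ + b - x j₀).toNat := by
    unfold depth
    exact Finset.inf'_le _ (Finset.mem_univ j₀)
  have hzj : z j₀ = x j₀ + (Pi.single (2 : Fin 4) (m : ℤ) : Fin 4 → ℤ) j₀ := rfl
  rw [hdz]
  by_cases hj : j₀ = 2
  · subst hj
    rw [Pi.single_eq_same] at hzj
    rw [hzj]
    omega
  · rw [Pi.single_eq_of_ne hj, add_zero] at hzj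
    rw [hzj]
    omega

/-- **Geometry of a deep pair.**  For `ν = ‖y − x‖ ≥ 1`, `m = ⌈ν⌉` and a collar `(2κ' + 2κ₇ + 4) ν` at `x` and `y`:
`1 ≤ m`, `ν ≤ m ≤ 2ν`, `8m ≤ b + 3`, and the axis pair `(x, x + m e₂)` has depth `≥ κ' m` and `≥ κ₇ m` at both ends,
while `x, y` have depth `≥ κ' ν` and `≥ κ₇ m`. [folklore] -/
theorem pair_geometry {c : Fin 4 → ℤ} {b : ℕ} {x y : Fin 4 → ℤ} {κ' κ₇ : ℕ} (hκ' : 8 ≤ κ') (m : ℕ)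
    (hm : m = ⌈‖siteToE (y - x)‖⌉₊) (hν1 : 1 ≤ ‖siteToE (y - x)‖)
    (hdx : ((2 * κ' + 2 * κ₇ + 4 : ℕ) : ℝ) * ‖siteToE (y - x)‖ ≤ depth c b x)
    (hdy : ((2 * κ' + 2 * κ₇ + 4 : ℕ) : ℝ) * ‖siteToE (y - x)‖ ≤ depth c b y) :
    1 ≤ m ∧ ‖siteToE (y - x)‖ ≤ m ∧ (m : ℝ) ≤ 2 * ‖siteToE (y - x)‖ ∧ (m : ℝ) < ‖siteToE (y - x)‖ + 1 ∧
      8 * m ≤ b + 3 ∧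
      κ' * m ≤ depth c b x ∧ κ' * m ≤ depth c b (x + Pi.single (2 : Fin 4) (m : ℤ)) ∧
      (κ' : ℝ) * ‖siteToE (y - x)‖ ≤ depth c b x ∧ (κ' : ℝ) * ‖siteToE (y - x)‖ ≤ depth c b y ∧
      (κ₇ : ℝ) * m ≤ depth c b x ∧ (κ₇ : ℝ) * m ≤ depth c b y ∧
      (κ₇ : ℝ) * m ≤ depth c b (x + Pi.single (2 : Fin 4) (m : ℤ)) := by
  have hνm : ‖siteToE (y - x)‖ ≤ m := by rw [hm]; exact Nat.le_ceil _
  have hm1r : (m : ℝ) < ‖siteToE (y - x)‖ + 1 := by rw [hm]; exact Nat.ceil_lt_add_one (by linarith)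
  have hm2 : (m : ℝ) ≤ 2 * ‖siteToE (y - x)‖ := by linarith
  have hm1 : 1 ≤ m := by
    have : (1 : ℝ) ≤ m := hν1.trans hνm
    exact_mod_cast this
  have hm0 : (0 : ℝ) < m := by exact_mod_cast hm1
  -- depths as reals
  have hcast : ((2 * κ' + 2 * κ₇ + 4 : ℕ) : ℝ) = 2 * κ' + 2 * κ₇ + 4 := by push_cast; ring
  rw [hcast] at hdx hdy
  have hκ'0 : (0 : ℝ) ≤ κ' := Nat.cast_nonneg _
  have hκ₇0 : (0 : ℝ) ≤ κ₇ := Nat.cast_nonneg _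
  have hν0 : 0 ≤ ‖siteToE (y - x)‖ := norm_nonneg _
  -- the shifted end: `depth (x + m e₂) ≥ depth x − m`
  have hlip : (depth c b x : ℝ) ≤ depth c b (x + Pi.single (2 : Fin 4) (m : ℤ)) + m := by
    exact_mod_cast depth_le_depth_add_single_add c b x m
  have hb : 2 * (depth c b x : ℝ) ≤ b + 1 := by exact_mod_cast two_mul_depth_le c b x
  have hκ'8 : (8 : ℝ) ≤ κ' := by exact_mod_cast hκ'
  have hA : (κ' : ℝ) * m ≤ 2 * κ' * ‖siteToE (y - x)‖ := by nlinarith [hm2, hκ'0]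
  have hB : (κ₇ : ℝ) * m ≤ 2 * κ₇ * ‖siteToE (y - x)‖ := by nlinarith [hm2, hκ₇0]
  have h20 : 20 * ‖siteToE (y - x)‖ ≤ depth c b x := by nlinarith [hdx, hκ'8, hκ₇0, hν0]
  have hshift : (2 * κ' + 2 * κ₇ + 2) * ‖siteToE (y - x)‖ ≤ depth c b (x + Pi.single (2 : Fin 4) (m : ℤ)) := by
    nlinarith [hdx, hlip, hm2]
  refine ⟨hm1, hνm, hm2, hm1r, ?_, ?_, ?_, ?_, ?_, ?_, ?_, ?_⟩
  · have : 8 * (m : ℝ) ≤ b + 3 := by nlinarith [h20, hb, hm2]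
    exact_mod_cast this
  · have : (κ' : ℝ) * m ≤ depth c b x := by nlinarith [hA, hdx, hκ₇0, hν0]
    exact_mod_cast this
  · have : (κ' : ℝ) * m ≤ depth c b (x + Pi.single (2 : Fin 4) (m : ℤ)) := by nlinarith [hA, hshift, hκ₇0, hν0]
    exact_mod_cast this
  · nlinarith [hdx, hκ'0, hκ₇0, hν0]
  · nlinarith [hdy, hκ'0, hκ₇0, hν0]
  · nlinarith [hB, hdx, hκ'0, hν0]
  · nlinarith [hB, hdy, hκ'0, hν0]
  · nlinarith [hB, hshift, hκ'0, hν0]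

/-! ### Real arithmetic of the constants -/

/-- The fixed gate parameter `κ_U = ⌈2√C_g⌉ + ⌈2√C_g'⌉ + 8`: `8 ≤ κ_U`, `4C_g ≤ κ_U²`, `4C_g' ≤ κ_U²`. [folklore] -/
theorem kappaU_spec {Cg Cg' : ℝ} (hCg : 0 ≤ Cg) (hCg' : 0 ≤ Cg') :
    8 ≤ ⌈2 * Real.sqrt Cg⌉₊ + ⌈2 * Real.sqrt Cg'⌉₊ + 8 ∧
      4 * Cg ≤ ((⌈2 * Real.sqrt Cg⌉₊ + ⌈2 * Real.sqrt Cg'⌉₊ + 8 : ℕ) : ℝ) ^ 2 ∧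
      4 * Cg' ≤ ((⌈2 * Real.sqrt Cg⌉₊ + ⌈2 * Real.sqrt Cg'⌉₊ + 8 : ℕ) : ℝ) ^ 2 := by
  have h1 : 2 * Real.sqrt Cg ≤ ⌈2 * Real.sqrt Cg⌉₊ := Nat.le_ceil _
  have h2 : 2 * Real.sqrt Cg' ≤ ⌈2 * Real.sqrt Cg'⌉₊ := Nat.le_ceil _
  have hs1 := Real.sq_sqrt hCg
  have hs2 := Real.sq_sqrt hCg'
  have hq1 := Real.sqrt_nonneg Cg
  have hq2 := Real.sqrt_nonneg Cg'
  refine ⟨by omega, ?_, ?_⟩ <;> push_cast <;> nlinarith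

/-- A larger gate parameter inherits the bounds. [folklore] -/
theorem kappa_mono {Cg : ℝ} {κ κ' : ℕ} (h : 4 * Cg ≤ (κ : ℝ) ^ 2) (hle : κ ≤ κ') : 4 * Cg ≤ (κ' : ℝ) ^ 2 := by
  have : (κ : ℝ) ≤ κ' := by exact_mod_cast hle
  have h0 : (0 : ℝ) ≤ κ := Nat.cast_nonneg _
  nlinarith

/-- The triple square root: for `X ≥ 0`, `ρ = √√√X` has `ρ ≥ 0` and `ρ⁸ = X`. [folklore] -/
theorem sqrt3_pow_eight {X : ℝ} (hX : 0 ≤ X) :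
    0 ≤ Real.sqrt (Real.sqrt (Real.sqrt X)) ∧ Real.sqrt (Real.sqrt (Real.sqrt X)) ^ 8 = X := by
  refine ⟨Real.sqrt_nonneg _, ?_⟩
  have h1 := Real.sq_sqrt hX
  have h2 := Real.sq_sqrt (Real.sqrt_nonneg X)
  have h3 := Real.sq_sqrt (Real.sqrt_nonneg (Real.sqrt X))
  calc Real.sqrt (Real.sqrt (Real.sqrt X)) ^ 8 = ((Real.sqrt (Real.sqrt (Real.sqrt X)) ^ 2) ^ 2) ^ 2 := by ring
    _ = X := by rw [h3, h2, h1]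


end StubInherit

/-! ### Registered sub-goal (closed form) -/

/-- **Geometry of a deep pair — registered sub-goal `pairGeometry` of crux stmt-QuantumFields-16207 (line
`inherited-amplitude-gates`, stub `stub_inherit`), closed form of `StubInherit.pair_geometry`.** [folklore] -/
theorem pairGeometry : ∀ (c : Fin 4 → ℤ) (b : ℕ) (x y : Fin 4 → ℤ) (κ' κ₇ : ℕ), 8 ≤ κ' → ∀ (m : ℕ), m = ⌈‖siteToE (y - x)‖⌉₊ → 1 ≤ ‖siteToE (y - x)‖ → ((2 * κ' + 2 * κ₇ + 4 : ℕ) : ℝ) * ‖siteToE (y - x)‖ ≤ depth c b x → ((2 * κ' + 2 * κ₇ + 4 : ℕ) : ℝ) * ‖siteToE (y - x)‖ ≤ depth c b y → 1 ≤ m ∧ ‖siteToE (y - x)‖ ≤ m ∧ (m : ℝ) ≤ 2 * ‖siteToE (y - x)‖ ∧ (m : ℝ) < ‖siteToE (y - x)‖ + 1 ∧ 8 * m ≤ b + 3 ∧ κ' * m ≤ depth c b x ∧ κ' * m ≤ depth c b (x + Pi.single (2 : Fin 4) (m : ℤ)) ∧ (κ' : ℝ) * ‖siteToE (y - x)‖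 ≤ depth c b x ∧ (κ' : ℝ) * ‖siteToE (y - x)‖ ≤ depth c b y ∧ (κ₇ : ℝ) * m ≤ depth c b x ∧ (κ₇ : ℝ) * m ≤ depth c b y ∧ (κ₇ : ℝ) * m ≤ depth c b (x + Pi.single (2 : Fin 4) (m : ℤ)) := by
  intro c b x y κ' κ₇ hκ' m hm hν1 hdx hdy
  exact StubInherit.pair_geometry hκ' m hm hν1 hdx hdy

end Summit.QuantumFields.YangMills.Cruxes.OSLegsAtWeakCouplingC.InheritedAmplitudeGates

end
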